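import Literature.AlgebraicGeometry.Resolution.PointBlowupDirectrixRank
import HarnessLib

/-!
# (K-Φ3) label propagation III: the FORM LEMMA behind «the arrival frame is a label» (memo §6.2 (P2))

Cell `res-dim4-pi` (D-0157 DOOR 2), Φ = β_h line of res-dim4-idea-1 (CARD I-1-6/7/8; memo
`pub/res-dim4/res-dim4-idea-1/B-infinity-critical-frame.md` §6.2 (P2) «ARRIVAL FRAME IS A LABEL», K-read SOUND by crit-4 g3 03:07:40Z).
The binder `hδ : μ! < deltaS (a k) (J k) μ` of `PhiLine.keepCount_add_betaS_le` for the ARRIVAL frame says that the transported frame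
`(z′; u′)` of the child is again a LABEL, i.e. `in_d(G′) ∈ K[in z′]`. (P2) derives it from three facts about the tangent form
`Φ = in_d(G′_clean) ∈ K[Z′, U′]` (degree `d < p`): (i) `e(Φ) ≤ r` — the child is in the class, `finrank (resVertex child) = 2 = 4 − r`;
(ii) the `U′`-free part `F(Z′) = Φ|_{U′ = 0}` needs all `r` variables, `e(F) = r` — it is the parent's tangent form; (iii) the monomials
`Z′^B U′_i`, `|B| = d − 1`, do not occur — the lattice points `(1,0)`, `(0,1)` of the transported polygon are empty (parent `α > 0` at
KEEP-h, `(2,0)` dissolved at LOSE-h). CONCLUSION: `Φ = F(Z′)` has no `U′` at all (so `δ′ > 1`).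

This file proves the conclusion from (i)–(iii) as a statement about an arbitrary polynomial `Φ ∈ K[σ]` with a set `U ⊆ σ` of
«u-indices», DEF-FREE over the tree's `PointBlowup.additiveSubspace Φ = ker (v ↦ D_vΦ = Σ v_i ∂_iΦ)` (`PointBlowupDirectrixRank`):

* `mem_additiveSubspace_iff_sum_smul_pderiv` (unfolding), `coeff_sum_smul_pderiv` (coefficients of `D_vΦ`);
* `apply_eq_zero_of_mem_additiveSubspace` — under (ii), a direction `v ∈ A(Φ)` vanishing on `U` is zero (restriction to `U` is
  injective on `A(Φ)`); `exists_mem_additiveSubspace_restrict_eq` — under (i)+(ii) every `U`-vector is the restriction of a direction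
  in `A(Φ)` (rank–nullity);
* **`pderiv_eq_zero_of_label_hypotheses`** — under (i)+(ii)+(iii), `∂_{U_i} Φ = 0` for every `i ∈ U`;
* **`apply_eq_zero_of_mem_support_of_label_hypotheses`** — if moreover the `U`-exponents of `Φ` are `< p = char K` (e.g. `Φ` homogeneous of
  degree `d < p`: `apply_lt_of_isHomogeneous_of_lt`), then NO monomial of `Φ` involves a `U`-variable: `Φ ∈ K[Z]`
  (`eq_zero_of_pderiv_eq_zero_of_apply_lt`: `∂_iΦ = 0` with `i`-exponents `< p` kills the variable `i`).

Only first derivatives are used (no Hasse–Taylor): for `t = e_i + v ∈ A(Φ)` with `v` supported on `Z`, the `U`-free part of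
`0 = D_tΦ = ∂_iΦ + D_vΦ` is `D_vF` by (iii), so `v = 0` by (ii) and `∂_iΦ = 0`. [OURS · counted 0 · AI work weaker than expert review.]
Nothing here proves K2(p), `NoAboveFloorTrap`, the β_h line, or resolution of singularities in dimension ≥ 4 / characteristic p.

Sources: V. Cossart, U. Jannsen, S. Saito, LNM **2270** (2020), Def. 2.18/2.21 (directrix, `e`), Thm. 8.3, Lemma 12.2 (2)
[`CossartJannsenSaito2020`] — (P2) REPLACES the use of Thm. 8.3 / «very near ⇒ prelabel» there; J. Berthomieu, P. Hivert, H. Mourtada,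
(2010), Cor. 2.3 (ridge via the gradient span) [`BerthomieuHivertMourtada2010`].
-/

noncomputable section

open MvPolynomial Finset
open Literature.AlgebraicGeometry.Resolution.PointBlowup (additiveSubspace polarMap killVars)

set_option linter.dupNamespace false

namespace Summit.ResolutionOfSingularities.ResolutionOfSingularities.Theorems.PIDim4.PhiLine

variable {K : Type*} [Field K] {σ : Type*}

/-! ## The additive subspace as the kernel of `v ↦ Σ v_i ∂_iΦ` -/

/-- `v ∈ A(Φ) ⟺ Σ_i v_i ∂_iΦ = 0` (unfolding of `PointBlowup.additiveSubspace = ker polarMap`). [cite: BerthomieuHivertMourtada2010, Cor. 2.3] -/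
theorem mem_additiveSubspace_iff_sum_smul_pderiv [Fintype σ] [DecidableEq σ] (Φ : MvPolynomial σ K) (v : σ → K) :
    v ∈ additiveSubspace Φ ↔ ∑ i, v i • pderiv i Φ = 0 := by
  rw [additiveSubspace, LinearMap.mem_ker, polarMap, Fintype.linearCombination_apply]

/-- Coefficients of `D_vΦ = Σ_i v_i ∂_iΦ`: `coeff_β = Σ_i v_i · coeff_{β + e_i} Φ · (β_i + 1)`. [folklore] -/
theorem coeff_sum_smul_pderiv [Fintype σ] (Φ : MvPolynomial σ K) (v : σ → K) (β : σ →₀ ℕ) :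
    coeff β (∑ i, v i • pderiv i Φ) = ∑ i, v i * (coeff (β + Finsupp.single i 1) Φ * (β i + 1)) := by
  rw [coeff_sum]
  refine Finset.sum_congr rfl fun i _ => ?_
  rw [coeff_smul, coeff_pderiv, smul_eq_mul]

/-! ## Hypothesis (ii): the `U`-free part needs all `Z`-variables — restriction to `U` is injective on `A(Φ)` -/

section Label

variable [Fintype σ] [DecidableEq σ] (U : Finset σ) (Φ : MvPolynomial σ K)

/-- Under (ii) «a `Z`-supported direction whose derivative `D_vΦ` has no `U`-free monomial is zero», a direction of `A(Φ)` vanishing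
on `U` is zero. [cite: CossartJannsenSaito2020, Def. 2.18] -/
theorem apply_eq_zero_of_mem_additiveSubspace
    (hF : ∀ v : σ → K, (∀ i ∈ U, v i = 0) →
      (∀ β : σ →₀ ℕ, (∀ j ∈ U, β j = 0) → coeff β (∑ i, v i • pderiv i Φ) = 0) → v = 0)
    {v : σ → K} (hv : v ∈ additiveSubspace Φ) (hvU : ∀ i ∈ U, v i = 0) : v = 0 := by
  refine hF v hvU fun β _ => ?_
  rw [(mem_additiveSubspace_iff_sum_smul_pderiv Φ v).mp hv, coeff_zero]

/-- Under (i) `|U| ≤ dim A(Φ)` and (ii), every vector on `U` is the restriction of a direction in `A(Φ)` (restriction `A(Φ) → K^U` is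
injective by (ii), hence bijective by rank–nullity). [cite: CossartJannsenSaito2020, Def. 2.18] -/
theorem exists_mem_additiveSubspace_restrict_eq (hT : U.card ≤ Module.finrank K (additiveSubspace Φ))
    (hF : ∀ v : σ → K, (∀ i ∈ U, v i = 0) →
      (∀ β : σ →₀ ℕ, (∀ j ∈ U, β j = 0) → coeff β (∑ i, v i • pderiv i Φ) = 0) → v = 0)
    (g : U → K) : ∃ t ∈ additiveSubspace Φ, ∀ i : U, t i = g i := by
  set T := additiveSubspace Φ with hTdef
  set ρ : T →ₗ[K] (U → K) := (LinearMap.funLeft K K (Subtype.val : U → σ)) ∘ₗ T.subtype with hρ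
  have hρinj : Function.Injective ρ := by
    refine (injective_iff_map_eq_zero ρ).mpr fun t ht => ?_
    have h0 : (t : σ → K) = 0 := by
      refine apply_eq_zero_of_mem_additiveSubspace U Φ hF t.2 fun i hi => ?_
      have := congrFun ht ⟨i, hi⟩
      simpa [hρ] using this
    exact Subtype.ext h0
  have hle : Module.finrank K T ≤ Module.finrank K (U → K) := LinearMap.finrank_le_finrank_of_injective hρinj
  have hcard : Module.finrank K (U → K) = U.card := by
    rw [Module.finrank_fintype_fun_eq_card, Fintype.card_coe]
  have heq : Module.finrank K T = Module.finrank K (U → K) := le_antisymm hle (by rw [hcard]; exact hT)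
  have hρsurj : Function.Surjective ρ := (LinearMap.injective_iff_surjective_of_finrank_eq_finrank heq).mp hρinj
  obtain ⟨t, ht⟩ := hρsurj g
  refine ⟨t, t.2, fun i => ?_⟩
  have := congrFun ht i
  simpa [hρ] using this

/-- **(P2), derivative form.** Under (i) `|U| ≤ dim A(Φ)`, (ii) (the `U`-free part needs all `Z`-variables) and (iii) «no monomial
`Z^B U_i`» (`coeff_{β + e_i} Φ = 0` whenever `β` is `U`-free and `i ∈ U`), every `∂_{U_i}Φ` vanishes: the direction `e_i` itself lies
in `A(Φ)`. [cite: CossartJannsenSaito2020, Lemma 12.2 (2)] -/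
theorem pderiv_eq_zero_of_label_hypotheses (hT : U.card ≤ Module.finrank K (additiveSubspace Φ))
    (hF : ∀ v : σ → K, (∀ i ∈ U, v i = 0) →
      (∀ β : σ →₀ ℕ, (∀ j ∈ U, β j = 0) → coeff β (∑ i, v i • pderiv i Φ) = 0) → v = 0)
    (h1 : ∀ i ∈ U, ∀ β : σ →₀ ℕ, (∀ j ∈ U, β j = 0) → coeff (β + Finsupp.single i 1) Φ = 0)
    {i : σ} (hi : i ∈ U) : pderiv i Φ = 0 := by
  classical
  -- a direction `t ∈ A(Φ)` whose `U`-part is `e_i`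
  obtain ⟨t, ht, htU⟩ := exists_mem_additiveSubspace_restrict_eq U Φ hT hF (fun j : U => if (j : σ) = i then 1 else 0)
  -- its `Z`-part `v`
  set v : σ → K := fun j => if j ∈ U then 0 else t j with hvdef
  have htv : t = v + Pi.single i 1 := by
    funext j
    by_cases hj : j ∈ U
    · have := htU ⟨j, hj⟩
      simp only at this
      rw [Pi.add_apply, hvdef]
      simp only [hj, if_true, zero_add, this, Pi.single_apply]
    · have hji : j ≠ i := fun h => hj (h ▸ hi)
      rw [Pi.add_apply, hvdef]
      simp [hj, hji]
  have hsum : ∑ j, t j • pderiv j Φ = (∑ j, v j • pderiv j Φ) + pderiv i Φ := by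
    rw [htv]
    simp only [Pi.add_apply, add_smul, Finset.sum_add_distrib]
    congr 1
    rw [Finset.sum_eq_single i (fun j _ hji => by rw [Pi.single_eq_of_ne hji, zero_smul])
      (fun h => absurd (Finset.mem_univ i) h), Pi.single_eq_same, one_smul]
  have hD : (∑ j, v j • pderiv j Φ) + pderiv i Φ = 0 := by
    rw [← hsum]; exact (mem_additiveSubspace_iff_sum_smul_pderiv Φ t).mp ht
  -- the `U`-free coefficients of `D_vΦ` vanish by (iii), so `v = 0` by (ii)
  have hv0 : v = 0 := by
    refine hF v (fun j hj => by rw [hvdef]; simp [hj]) fun β hβ => ?_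
    have h := congrArg (coeff β) hD
    rw [coeff_add, coeff_zero, coeff_pderiv, h1 i hi β hβ, zero_mul, add_zero] at h
    exact h
  rw [hv0, Finset.sum_eq_zero (fun j _ => by rw [Pi.zero_apply, zero_smul]), zero_add] at hD
  exact hD

end Label

/-! ## From `∂_iΦ = 0` to «`Φ` does not involve the variable `i`» (exponents below the characteristic) -/

/-- If `∂_iΦ = 0` and every `i`-exponent of `Φ` is `< p = char K` (or `K` has characteristic `0`, `p = 0` excluded by the bound),
then no monomial of `Φ` involves the variable `i`. [folklore] -/
theorem eq_zero_of_pderiv_eq_zero_of_apply_lt (p : ℕ) [CharP K p] {Φ : MvPolynomial σ K} {i : σ} (hΦ : pderiv i Φ = 0)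
    (hlt : ∀ m ∈ Φ.support, m i < p) {m : σ →₀ ℕ} (hm : m ∈ Φ.support) : m i = 0 := by
  by_contra hne
  obtain ⟨k, hk⟩ : ∃ k, m i = k + 1 := ⟨m i - 1, by omega⟩
  set β := m - Finsupp.single i 1 with hβ
  have hβm : β + Finsupp.single i 1 = m := by
    rw [hβ]
    ext j
    by_cases hji : j = i
    · subst hji; simp; omega
    · simp [hji]
  have h := congrArg (coeff β) hΦ
  rw [coeff_pderiv, coeff_zero, hβm] at h
  have hβi : β i + 1 = m i := by rw [hβ]; simp; omega
  rcases mul_eq_zero.mp h with h0 | h0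
  · exact (mem_support_iff.mp hm) h0
  · have hcast : ((β i + 1 : ℕ) : K) = 0 := by exact_mod_cast h0
    rw [CharP.cast_eq_zero_iff K p] at hcast
    have hlt' := hlt m hm
    rw [← hβi] at hlt'
    have hpos : 0 < β i + 1 := Nat.succ_pos _
    exact absurd (Nat.le_of_dvd hpos hcast) (by omega)

/-- A homogeneous polynomial of degree `d` has all exponents `≤ d`; so `d < p` bounds every exponent below `p`. [folklore] -/
theorem apply_lt_of_isHomogeneous_of_lt {Φ : MvPolynomial σ K} {d p : ℕ} (hΦ : Φ.IsHomogeneous d) (hdp : d < p)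
    {m : σ →₀ ℕ} (hm : m ∈ Φ.support) (i : σ) : m i < p := by
  have hdeg : m.degree = d := by
    have h := hΦ (mem_support_iff.mp hm)
    rw [Finsupp.degree_eq_weight_one]
    exact h
  have := Finsupp.le_degree i m
  omega

/-- **(P2), conclusion: «the arrival frame is a label».** Under (i) `|U| ≤ dim A(Φ)`, (ii), (iii) and `U`-exponents `< p = char K`, NO
monomial of `Φ` involves a `U`-variable: `Φ` is a polynomial in the `Z`-variables alone (for the tangent form of the child in the
transported frame: `in_d(G′) ∈ K[Z′]`, i.e. `δ′ > 1`). [cite: CossartJannsenSaito2020, Lemma 12.2 (2)] -/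
theorem apply_eq_zero_of_mem_support_of_label_hypotheses [Fintype σ] [DecidableEq σ] (p : ℕ) [CharP K p] (U : Finset σ)
    (Φ : MvPolynomial σ K)
    (hT : U.card ≤ Module.finrank K (additiveSubspace Φ))
    (hF : ∀ v : σ → K, (∀ i ∈ U, v i = 0) →
      (∀ β : σ →₀ ℕ, (∀ j ∈ U, β j = 0) → coeff β (∑ i, v i • pderiv i Φ) = 0) → v = 0)
    (h1 : ∀ i ∈ U, ∀ β : σ →₀ ℕ, (∀ j ∈ U, β j = 0) → coeff (β + Finsupp.single i 1) Φ = 0)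
    (hlt : ∀ m ∈ Φ.support, ∀ i ∈ U, m i < p) {m : σ →₀ ℕ} (hm : m ∈ Φ.support) {i : σ} (hi : i ∈ U) : m i = 0 :=
  eq_zero_of_pderiv_eq_zero_of_apply_lt p (pderiv_eq_zero_of_label_hypotheses U Φ hT hF h1 hi)
    (fun m' hm' => hlt m' hm' i hi) hm


/-! ## The same with the `U`-free part `killVars U Φ` (tree: `PointBlowup.killVars`, CJS (9.7) `ρ_M`) -/

section KillVars

variable [DecidableEq σ] (U : Finset σ)

/-- `ρ_U` keeps a `U`-free monomial. [cite: CossartJannsenSaito2020, Setup B (9.7)] -/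
theorem killVars_monomial_of_forall {d : σ →₀ ℕ} (hd : ∀ i ∈ U, d i = 0) (c : K) :
    killVars U (monomial d c) = monomial d c := by
  unfold killVars
  rw [aeval_monomial, algebraMap_eq]
  have hprod : (d.prod fun i k => ((if i ∈ U then 0 else X i : MvPolynomial σ K)) ^ k) = ∏ i ∈ d.support, X i ^ d i := by
    rw [Finsupp.prod]
    refine Finset.prod_congr rfl fun i hi => ?_
    rw [if_neg (fun h => (Finsupp.mem_support_iff.mp hi) (hd i h))]
  rw [hprod, prod_X_pow_eq_monomial, C_mul_monomial, mul_one]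

/-- `ρ_U` kills a monomial involving a `U`-variable. [cite: CossartJannsenSaito2020, Setup B (9.7)] -/
theorem killVars_monomial_of_ne_zero {d : σ →₀ ℕ} {i : σ} (hi : i ∈ U) (hdi : d i ≠ 0) (c : K) :
    killVars U (monomial d c) = 0 := by
  unfold killVars
  rw [aeval_monomial, Finsupp.prod, Finset.prod_eq_zero (Finsupp.mem_support_iff.mpr hdi), mul_zero]
  rw [if_pos hi, zero_pow hdi]

/-- Coefficients of `ρ_U P` at a `U`-free exponent. [cite: CossartJannsenSaito2020, Setup B (9.7)] -/
theorem coeff_killVars_of_forall (P : MvPolynomial σ K) {γ : σ →₀ ℕ} (hγ : ∀ i ∈ U, γ i = 0) :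
    coeff γ (killVars U P) = coeff γ P := by
  induction P using MvPolynomial.induction_on' with
  | monomial d c =>
    by_cases hd : ∀ i ∈ U, d i = 0
    · rw [killVars_monomial_of_forall U hd]
    · push Not at hd
      obtain ⟨i, hi, hdi⟩ := hd
      rw [killVars_monomial_of_ne_zero U hi hdi, coeff_zero, coeff_monomial, if_neg]
      rintro rfl
      exact hdi (hγ i hi)
  | add f g hf hg => rw [map_add, coeff_add, coeff_add, hf, hg]

/-- Coefficients of `ρ_U P` at an exponent involving `U` vanish. [cite: CossartJannsenSaito2020, Setup B (9.7)] -/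
theorem coeff_killVars_of_ne_zero (P : MvPolynomial σ K) {γ : σ →₀ ℕ} {i : σ} (hi : i ∈ U) (hγi : γ i ≠ 0) :
    coeff γ (killVars U P) = 0 := by
  induction P using MvPolynomial.induction_on' with
  | monomial d c =>
    by_cases hd : ∀ i ∈ U, d i = 0
    · rw [killVars_monomial_of_forall U hd, coeff_monomial, if_neg]
      rintro rfl
      exact hγi (hd i hi)
    · push Not at hd
      obtain ⟨i', hi', hdi'⟩ := hd
      rw [killVars_monomial_of_ne_zero U hi' hdi', coeff_zero]
  | add f g hf hg => rw [map_add, coeff_add, hf, hg, add_zero]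

/-- `ρ_U P = 0` iff every `U`-free coefficient of `P` vanishes. [cite: CossartJannsenSaito2020, Setup B (9.7)] -/
theorem killVars_eq_zero_iff_forall_coeff (P : MvPolynomial σ K) :
    killVars U P = 0 ↔ ∀ β : σ →₀ ℕ, (∀ j ∈ U, β j = 0) → coeff β P = 0 := by
  constructor
  · intro h β hβ
    rw [← coeff_killVars_of_forall U P hβ, h, coeff_zero]
  · intro h
    ext β
    rw [coeff_zero]
    by_cases hβ : ∀ j ∈ U, β j = 0
    · rw [coeff_killVars_of_forall U P hβ, h β hβ]
    · push Not at hβ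
      obtain ⟨j, hj, hβj⟩ := hβ
      exact coeff_killVars_of_ne_zero U P hj hβj

/-- `ρ_U P = P` iff no monomial of `P` involves a `U`-variable. [cite: CossartJannsenSaito2020, Setup B (9.7)] -/
theorem killVars_eq_self_iff_forall_support (P : MvPolynomial σ K) :
    killVars U P = P ↔ ∀ m ∈ P.support, ∀ i ∈ U, m i = 0 := by
  constructor
  · intro h m hm i hi
    by_contra hmi
    have := coeff_killVars_of_ne_zero U P hi hmi
    rw [h] at this
    exact (mem_support_iff.mp hm) this
  · intro h
    ext β
    by_cases hβ : ∀ j ∈ U, β j = 0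
    · exact coeff_killVars_of_forall U P hβ
    · push Not at hβ
      obtain ⟨j, hj, hβj⟩ := hβ
      rw [coeff_killVars_of_ne_zero U P hj hβj]
      by_contra hne
      exact hβj (h β (mem_support_iff.mpr (Ne.symm hne)) j hj)

/-- For a `Z`-supported direction `v`, `ρ_U (D_vΦ) = D_v (ρ_U Φ)` (`∂_k` commutes with `ρ_U` for `k ∉ U`).
[cite: CossartJannsenSaito2020, Setup B (9.7)] -/
theorem killVars_sum_smul_pderiv [Fintype σ] (Φ : MvPolynomial σ K) {v : σ → K} (hv : ∀ i ∈ U, v i = 0) :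
    killVars U (∑ k, v k • pderiv k Φ) = ∑ k, v k • pderiv k (killVars U Φ) := by
  rw [map_sum]
  refine Finset.sum_congr rfl fun k _ => ?_
  by_cases hk : k ∈ U
  · rw [hv k hk, zero_smul, zero_smul, map_zero]
  · rw [map_smul]
    congr 1
    ext γ
    by_cases hγ : ∀ j ∈ U, γ j = 0
    · have hγ' : ∀ j ∈ U, (γ + Finsupp.single k 1 : σ →₀ ℕ) j = 0 := fun j hj => by
        have hjk : j ≠ k := fun h => hk (h ▸ hj)
        rw [Finsupp.add_apply, hγ j hj, Finsupp.single_eq_of_ne hjk, add_zero]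
      rw [coeff_killVars_of_forall U _ hγ, coeff_pderiv, coeff_pderiv, coeff_killVars_of_forall U _ hγ']
    · push Not at hγ
      obtain ⟨j, hj, hγj⟩ := hγ
      have hγj' : (γ + Finsupp.single k 1 : σ →₀ ℕ) j ≠ 0 := by rw [Finsupp.add_apply]; omega
      rw [coeff_killVars_of_ne_zero U _ hj hγj, coeff_pderiv, coeff_killVars_of_ne_zero U _ hj hγj', zero_mul]

/-- Hypothesis (ii) of (P2) from its directrix form: if the additive subspace of the `U`-free part `F = ρ_U Φ` meets the
`Z`-supported directions trivially («`e(F) = r`»), then a `Z`-supported direction whose `D_vΦ` has no `U`-free monomial is zero.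
[cite: CossartJannsenSaito2020, Def. 2.18] -/
theorem label_hypothesis_ii_of_additiveSubspace_killVars [Fintype σ] (Φ : MvPolynomial σ K)
    (hF' : ∀ v ∈ additiveSubspace (killVars U Φ), (∀ i ∈ U, v i = 0) → v = 0) (v : σ → K) (hvU : ∀ i ∈ U, v i = 0)
    (hcoeff : ∀ β : σ →₀ ℕ, (∀ j ∈ U, β j = 0) → coeff β (∑ i, v i • pderiv i Φ) = 0) : v = 0 := by
  refine hF' v ?_ hvU
  rw [mem_additiveSubspace_iff_sum_smul_pderiv, ← killVars_sum_smul_pderiv U Φ hvU]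
  exact (killVars_eq_zero_iff_forall_coeff U _).mpr hcoeff

/-- **(P2) in directrix language: «the arrival frame is a label».** Let `Φ ∈ K[Z, U]` be homogeneous of degree `d < p = char K`
with (i) `|U| ≤ dim A(Φ)` («`e(Φ) ≤ r`»), (ii) `A(ρ_U Φ)` meets the `Z`-supported directions trivially («`e(F) = r`» for the `U`-free part
`F`), (iii) `ρ_U (∂_{U_i} Φ) = 0` for `i ∈ U` (no monomials `Z^B U_i`). Then `ρ_U Φ = Φ`: the form involves no `U`-variable.
[cite: CossartJannsenSaito2020, Lemma 12.2 (2)] -/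
theorem killVars_eq_self_of_label_hypotheses [Fintype σ] (p : ℕ) [CharP K p] {d : ℕ} (Φ : MvPolynomial σ K)
    (hΦ : Φ.IsHomogeneous d) (hdp : d < p) (hT : U.card ≤ Module.finrank K (additiveSubspace Φ))
    (hF' : ∀ v ∈ additiveSubspace (killVars U Φ), (∀ i ∈ U, v i = 0) → v = 0)
    (h1 : ∀ i ∈ U, killVars U (pderiv i Φ) = 0) : killVars U Φ = Φ := by
  rw [killVars_eq_self_iff_forall_support]
  intro m hm i hi
  refine apply_eq_zero_of_mem_support_of_label_hypotheses p U Φ hT (label_hypothesis_ii_of_additiveSubspace_killVars U Φ hF')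
    (fun i hi β hβ => ?_) (fun m hm i _ => apply_lt_of_isHomogeneous_of_lt hΦ hdp hm i) hm hi
  have h := (killVars_eq_zero_iff_forall_coeff U _).mp (h1 i hi) β hβ
  rw [coeff_pderiv] at h
  rcases mul_eq_zero.mp h with h0 | h0
  · exact h0
  · exfalso
    have hcast : ((β i + 1 : ℕ) : K) = 0 := by exact_mod_cast h0
    rw [CharP.cast_eq_zero_iff K p] at hcast
    have : β i = 0 := hβ i hi
    rw [this, zero_add] at hcast
    exact CharP.char_ne_one K p (Nat.dvd_one.mp hcast)

end KillVars

end Summit.ResolutionOfSingularities.ResolutionOfSingularities.Theorems.PIDim4.PhiLine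

end
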